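import Literature.NumberTheory.Automorphic.RegularOrbitChartProductNonarch   -- ★ chart-2 `exists_openPartialHomeomorph_conjOrbit`
import Literature.LinearAlgebra.Matrix.RegularSemisimpleCentralizerGL            -- ★ `centralizer_gl_eq_of_mem` (the torus axiom (zz))
import Literature.LinearAlgebra.Matrix.SeparableCharpolyOpen                     -- ★ `isOpen_setOf_charpoly_separable`
import HarnessLib

/-!
# The regular saturation `⋃_x x (T ∩ G_reg) x⁻¹` of the centraliser torus of a regular semisimple element of `GL_N(F)` is OPEN
(Harish-Chandra (1970), Lemma 42: `G_A = (A′)^G` is open — the submersivity of `(x, t) ↦ x t x⁻¹` on `G × A′`)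

Topic `NumberTheory/Automorphic`; namespace `Literature.NumberTheory.Automorphic`.  Theorems only (no definition, no named fact,
no instance, no `sorry`).  Over ★ `RegularOrbitChartProductNonarch` (the regular orbit chart in product form: near a regular
semisimple `t`, every matrix is `(1 + X)(t + Y)(1 + X)⁻¹` with `Y` in the commutant of `t`, Mathlib's inverse function theorem over
the complete field `F`), ★ `RegularSemisimpleCentralizerGL` (`Z(s) = Z(A)` for regular `s ∈ Z(A)`) and ★ `SeparableCharpolyOpen`
(the regular semisimple locus is open).

THE RESULT (PROVED).  `F` a complete nontrivially normed perfect field (e.g. any finite extension of `ℚ_p`), `A ∈ GL_N(F)` with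
separable characteristic polynomial, `T = Z_{GL_N(F)}(A)` its centraliser torus, `R = {g | p_g separable}` the regular semisimple
locus.  Then
* `conj_mem_iUnion_conj_centralizer_inter` — the saturation `G^T := ⋃_x x (T ∩ R) x⁻¹` is conjugation invariant;
* **`isOpen_iUnion_conj_centralizer_inter_separable`** — `G^T` is OPEN in `GL_N(F)`: at `t ∈ T ∩ R` the chart writes every nearby
  invertible `w` as `(1 + X)(t + Y)(1 + X)⁻¹` with `t + Y` commuting with `t`, hence (axiom (zz)) in `Z(t) = T`, and regular for `Y`
  small; conjugation invariance moves this from `t` to every point of `G^T`.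
This is the torus axiom (op) of ★ `WeylVanishingCanonical.integral_eq_zero_of_forall_classOrbitalIntegral_eq_zero` at the matrix
level (road «W1s soft Weyl», P3b line «CMCharIdentityTest», stub `stub_weylVanishingSplit`), to be transported to `H_v ≅ GL₂ × GL₁`
along ★ `localSplitEquiv`.

## References
* [HarishChandra1970] Harish-Chandra (notes by G. van Dijk), *Harmonic Analysis on Reductive p-adic Groups*, LNM 162 (1970),
  Lemma 42 and Part I §3 (the map `G × A′ → G` is everywhere submersive; `G_A` open).
* [Borel1991] A. Borel, *Linear Algebraic Groups*, 2nd ed. (1991), IV.12.3.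
-/

set_option autoImplicit false

noncomputable section

open Filter Topology Set
open scoped Matrix.Norms.Operator

namespace Literature.NumberTheory.Automorphic

open Literature.LinearAlgebra.Matrix

section Saturation

variable {G : Type*} [Group G] (T : Subgroup G) (R : Set G)

/-- The saturation `⋃_x x (T ∩ R) x⁻¹` is invariant under conjugation. [cite: HarishChandra1970, Lemma 42] -/
theorem conj_mem_iUnion_conj_inter_iff (c y : G) :
    c * y * c⁻¹ ∈ (⋃ x : G, (fun t : G => x * t * x⁻¹) '' ((T : Set G) ∩ R)) ↔
      y ∈ ⋃ x : G, (fun t : G => x * t * x⁻¹) '' ((T : Set G) ∩ R) := by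
  simp only [mem_iUnion, mem_image]
  constructor
  · rintro ⟨x, t, ht, hxt⟩
    refine ⟨c⁻¹ * x, t, ht, ?_⟩
    have : y = c⁻¹ * (c * y * c⁻¹) * c := by group
    rw [this, ← hxt]; group
  · rintro ⟨x, t, ht, rfl⟩
    exact ⟨c * x, t, ht, by group⟩

end Saturation

section Open

variable {F : Type*} [NontriviallyNormedField F] [CompleteSpace F] [PerfectField F] {N : ℕ}

/-- **THE REGULAR SATURATION OF A REGULAR TORUS IS OPEN** (`GL_N` over a complete nontrivially normed perfect field): for `A ∈ GL_N(F)`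
with separable characteristic polynomial, `⋃_x x (Z(A) ∩ R) x⁻¹` is open, `R` the regular semisimple locus.  At `t ∈ Z(A) ∩ R` the
regular orbit chart (★ `exists_openPartialHomeomorph_conjOrbit`) presents every nearby matrix as `(1 + X)(t + Y)(1 + X)⁻¹` with `Y`
in the commutant of `t`; for `(X, Y)` small `1 + X` and `t + Y` are units, `t + Y` is regular, and it commutes with `t`, so lies in
`Z(t) = Z(A)` (★ `centralizer_gl_eq_of_mem`). [cite: HarishChandra1970, Lemma 42] [cite: Borel1991, IV.12.3] -/
theorem isOpen_iUnion_conj_centralizer_inter_separable {F : Type} [NontriviallyNormedField F] [CompleteSpace F] [PerfectField F]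
    {N : ℕ} (A : GL (Fin N) F) (hA : (A : Matrix (Fin N) (Fin N) F).charpoly.Separable) :
    IsOpen (⋃ x : GL (Fin N) F, (fun t : GL (Fin N) F => x * t * x⁻¹) ''
      (((Subgroup.centralizer ({A} : Set (GL (Fin N) F)) : Subgroup (GL (Fin N) F)) : Set (GL (Fin N) F)) ∩
        {g : GL (Fin N) F | (g : Matrix (Fin N) (Fin N) F).charpoly.Separable})) := by
  classical
  haveI : CompleteSpace (Matrix (Fin N) (Fin N) F) := FiniteDimensional.complete F (Matrix (Fin N) (Fin N) F)
  set S : Set (GL (Fin N) F) := ⋃ x : GL (Fin N) F, (fun t : GL (Fin N) F => x * t * x⁻¹) ''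
      (((Subgroup.centralizer ({A} : Set (GL (Fin N) F)) : Subgroup (GL (Fin N) F)) : Set (GL (Fin N) F)) ∩
        {g : GL (Fin N) F | (g : Matrix (Fin N) (Fin N) F).charpoly.Separable}) with hSdef
  rw [isOpen_iff_mem_nhds]
  intro y hy
  have hy' := hy
  simp only [hSdef, mem_iUnion, mem_image, mem_inter_iff, SetLike.mem_coe, mem_setOf_eq] at hy'
  obtain ⟨x, t, ⟨htZ, htR⟩, rfl⟩ := hy'
  -- STEP 1: `S` is a neighbourhood of `t` (the chart at `t`)
  have hnhds : S ∈ 𝓝 t := by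
    obtain ⟨e, h0, -, he⟩ := exists_openPartialHomeomorph_conjOrbit (t : Matrix (Fin N) (Fin N) F) htR
    -- the good parameters: in the source, `1 + X` a unit, `t + Y` a regular unit
    set V := e.source ∩
      ((fun p => (1 : Matrix (Fin N) (Fin N) F) + (p.1 : Matrix (Fin N) (Fin N) F)) ⁻¹' {m | IsUnit m} ∩
        (fun p => (t : Matrix (Fin N) (Fin N) F) + (p.2 : Matrix (Fin N) (Fin N) F)) ⁻¹'
          ({m : Matrix (Fin N) (Fin N) F | IsUnit m} ∩ {m | m.charpoly.Separable})) with hVdef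
    have hc1 : Continuous fun p : (↥(LinearMap.range (LinearMap.mulLeft F (t : Matrix (Fin N) (Fin N) F) -
        LinearMap.mulRight F (t : Matrix (Fin N) (Fin N) F) : Module.End F (Matrix (Fin N) (Fin N) F))) ×
          ↥(LinearMap.ker (LinearMap.mulLeft F (t : Matrix (Fin N) (Fin N) F) -
        LinearMap.mulRight F (t : Matrix (Fin N) (Fin N) F) : Module.End F (Matrix (Fin N) (Fin N) F)))) =>
        (1 : Matrix (Fin N) (Fin N) F) + (p.1 : Matrix (Fin N) (Fin N) F) :=
      continuous_const.add (continuous_subtype_val.comp continuous_fst)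
    have hc2 : Continuous fun p : (↥(LinearMap.range (LinearMap.mulLeft F (t : Matrix (Fin N) (Fin N) F) -
        LinearMap.mulRight F (t : Matrix (Fin N) (Fin N) F) : Module.End F (Matrix (Fin N) (Fin N) F))) ×
          ↥(LinearMap.ker (LinearMap.mulLeft F (t : Matrix (Fin N) (Fin N) F) -
        LinearMap.mulRight F (t : Matrix (Fin N) (Fin N) F) : Module.End F (Matrix (Fin N) (Fin N) F)))) =>
        (t : Matrix (Fin N) (Fin N) F) + (p.2 : Matrix (Fin N) (Fin N) F) :=
      continuous_const.add (continuous_subtype_val.comp continuous_snd)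
    have hVo : IsOpen V :=
      e.open_source.inter ((Units.isOpen.preimage hc1).inter
        ((Units.isOpen.inter (isOpen_setOf_charpoly_separable (E := F) (n := Fin N))).preimage hc2))
    have hVs : V ⊆ e.source := fun p hp => hp.1
    have h0V : (0 : _ × _) ∈ V := by
      refine ⟨h0, ?_, ?_⟩
      · simp only [mem_preimage, Prod.fst_zero, ZeroMemClass.coe_zero, add_zero, mem_setOf_eq]
        exact isUnit_one
      · simp only [mem_preimage, Prod.snd_zero, ZeroMemClass.coe_zero, add_zero, mem_inter_iff, mem_setOf_eq]
        exact ⟨Units.isUnit t, htR⟩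
    -- `W := e(V)` is an open neighbourhood of `t` in `M_N(F)`
    have hWo : IsOpen (e '' V) := (e.isOpen_image_iff_of_subset_source hVs).2 hVo
    have htW : (t : Matrix (Fin N) (Fin N) F) ∈ e '' V := by
      refine ⟨0, h0V, ?_⟩
      rw [he]
      simp only [Prod.fst_zero, Prod.snd_zero, ZeroMemClass.coe_zero, add_zero, Ring.inverse_one, mul_one, one_mul]
    -- its trace on `GL_N(F)` lies in `S`
    have hsub : (Units.val : GL (Fin N) F → Matrix (Fin N) (Fin N) F) ⁻¹' (e '' V) ⊆ S := by
      rintro g ⟨p, hpV, hgp⟩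
      obtain ⟨-, hu1, hu2, hsep⟩ := hpV
      change IsUnit ((1 : Matrix (Fin N) (Fin N) F) + (p.1 : Matrix (Fin N) (Fin N) F)) at hu1
      change IsUnit ((t : Matrix (Fin N) (Fin N) F) + (p.2 : Matrix (Fin N) (Fin N) F)) at hu2
      change ((t : Matrix (Fin N) (Fin N) F) + (p.2 : Matrix (Fin N) (Fin N) F)).charpoly.Separable at hsep
      set u : GL (Fin N) F := hu1.unit with hu
      set s : GL (Fin N) F := hu2.unit with hs
      have hus : (u : Matrix (Fin N) (Fin N) F) = 1 + (p.1 : Matrix (Fin N) (Fin N) F) := hu1.unit_spec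
      have hss : (s : Matrix (Fin N) (Fin N) F) = (t : Matrix (Fin N) (Fin N) F) + (p.2 : Matrix (Fin N) (Fin N) F) :=
        hu2.unit_spec
      -- `s` commutes with `t` (its perturbation lies in the commutant), hence lies in `Z(t) = Z(A)`
      have hY : (t : Matrix (Fin N) (Fin N) F) * (p.2 : Matrix (Fin N) (Fin N) F) =
          (p.2 : Matrix (Fin N) (Fin N) F) * (t : Matrix (Fin N) (Fin N) F) := by
        have := p.2.2
        rw [LinearMap.mem_ker, LinearMap.sub_apply, LinearMap.mulLeft_apply, LinearMap.mulRight_apply, sub_eq_zero] at this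
        exact this
      have hst : s ∈ Subgroup.centralizer ({t} : Set (GL (Fin N) F)) := by
        rw [Subgroup.mem_centralizer_singleton_iff]
        apply Units.ext
        rw [Units.val_mul, Units.val_mul, hss, add_mul, mul_add, hY]
      have hsZ : s ∈ Subgroup.centralizer ({A} : Set (GL (Fin N) F)) := by
        rw [← centralizer_gl_eq_of_mem A hA htZ htR]; exact hst
      have hsR : (s : Matrix (Fin N) (Fin N) F).charpoly.Separable := by rw [hss]; exact hsep
      -- `g = u s u⁻¹`
      have hg : g = u * s * u⁻¹ := by
        apply Units.ext
        rw [Units.val_mul, Units.val_mul, hus, hss, ← hgp, he, ← hus, Ring.inverse_unit]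
      rw [hg]
      simp only [hSdef, mem_iUnion, mem_image, mem_inter_iff, SetLike.mem_coe, mem_setOf_eq]
      exact ⟨u, s, ⟨hsZ, hsR⟩, rfl⟩
    exact Filter.mem_of_superset ((hWo.preimage Units.continuous_val).mem_nhds htW) hsub
  -- STEP 2: conjugation by `x` carries the neighbourhood to `x t x⁻¹`
  have hcont : Continuous fun g : GL (Fin N) F => x⁻¹ * g * x := by fun_prop
  have hpre : (fun g : GL (Fin N) F => x⁻¹ * g * x) ⁻¹' S ∈ 𝓝 (x * t * x⁻¹) := by
    refine hcont.continuousAt.preimage_mem_nhds ?_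
    have : x⁻¹ * (x * t * x⁻¹) * x = t := by group
    rw [this]; exact hnhds
  refine Filter.mem_of_superset hpre fun g hg => ?_
  have hg' : x⁻¹ * g * x⁻¹⁻¹ ∈ S := by rw [inv_inv]; exact hg
  exact (conj_mem_iUnion_conj_inter_iff (Subgroup.centralizer ({A} : Set (GL (Fin N) F)))
    {g : GL (Fin N) F | (g : Matrix (Fin N) (Fin N) F).charpoly.Separable} x⁻¹ g).1 hg'

end Open

end Literature.NumberTheory.Automorphic

end
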